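import Mathlib
import Summits.Ventures.PercRepro2.Defs
import Summits.Ventures.PercRepro2.Graph
import Summits.Ventures.PercRepro2.Events
import Summits.Ventures.PercRepro2.Harris
import Summits.Ventures.PercRepro2.Independence
import Summits.Ventures.PercRepro2.CutVertexPaths
import Summits.Ventures.PercRepro2.XWForm
import Summits.Ventures.PercRepro2.XWMore
import Summits.Ventures.PercRepro2.XWCutVertex
import Summits.Ventures.PercRepro2.XWEdgeSY
import Summits.Ventures.PercRepro2.XWGlue

/-!
# (XW) on the glued family WITH its `s–y` edge: the exact criterion in the kernel
(PercRepro2, p2 g27)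

XWGlue.lean computes the `s–y` defect on a cut-vertex configuration,
`D_sy = A₃·Δ_R + C₃·Δ_L − Δ_L·Δ_R`.  Here the three kernel theorems are composed on ONE graph:
let `e = {s, y}` be an edge of `G` such that `G − e` has a cut vertex `v` separating `{s, u}` from
`{y, o}` — formalised without deleting anything: re-attaching `e` as a loop at `v`
(`Function.update ends e s(v, v)`) gives a graph with a genuine `CutVertexM9.CutVertex`
structure, and a loop changes no connection (`conn_update_of_closed`) once `e` is closed, which is
sure under `p[e↦0]` (`prob_update_zero_congr`).  Then (`xwBil_eq_glue_edge`)

  **`XW(G, p) = p_e·(1 − p_e)·(A₃·Δ_R + C₃·Δ_L − Δ_L·Δ_R)`**,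

the block statistics read under `p[e↦0]`: `Δ_L = Cov(s ↔ v, s ↔ u)`, `A₃ = P(u ↔ v, s ↮ v)`,
`Δ_R = Cov(y ↔ v, y ↔ o)`, `C₃ = P(o ↔ v, y ↮ v)`.  Consequently (`xwBil_neg_iff_glue_edge`), for
`0 < p_e < 1`, **(XW) fails on `G` iff `Δ_L·Δ_R > A₃·Δ_R + C₃·Δ_L`** — the exact mechanism of
every (XW) witness of record (96 / 96 are of this shape, P2-G27-CYU.md §5b), the weight of the
`s–y` edge being irrelevant to the sign.  Own work (record proofs/P2-G27-CYU.md §5c); standard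
axioms.
-/

namespace Summit.Ventures.PercRepro2

namespace XWGlueEdge

open CutVertexM9 XWCut

variable {V : Type*} {E : Type*} [Fintype E] [DecidableEq E]
  {R : Type*} [CommRing R] [LinearOrder R] [IsStrictOrderedRing R]

/-! ## A closed edge may be re-attached anywhere -/

omit [Fintype E] in
/-- Re-attaching a closed edge does not change the open graph. -/
lemma openGraph_update_of_closed (ends : E → Sym2 V) {e : E} (x : Sym2 V) {ω : Config E}
    (hω : ω e = false) : openGraph (Function.update ends e x) ω = openGraph ends ω := by
  ext a b
  rw [openGraph_adj, openGraph_adj]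
  constructor
  · rintro ⟨hab, e', he', hends⟩
    refine ⟨hab, e', he', ?_⟩
    by_cases h : e' = e
    · subst h; rw [he'] at hω; exact Bool.noConfusion hω
    · rwa [Function.update_of_ne h] at hends
  · rintro ⟨hab, e', he', hends⟩
    refine ⟨hab, e', he', ?_⟩
    by_cases h : e' = e
    · subst h; rw [he'] at hω; exact Bool.noConfusion hω
    · rwa [Function.update_of_ne h]

omit [Fintype E] in
/-- Re-attaching a closed edge does not change any connection. -/
lemma conn_update_of_closed (ends : E → Sym2 V) {e : E} (x : Sym2 V) {ω : Config E}
    (hω : ω e = false) (a b : V) :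
    Conn (Function.update ends e x) ω a b ↔ Conn ends ω a b := by
  unfold Conn
  rw [openGraph_update_of_closed ends x hω]

omit [LinearOrder R] [IsStrictOrderedRing R] in
/-- Under `p[e↦0]`, events agreeing on `{e closed}` have the same probability. -/
lemma prob_update_zero_congr (p : E → R) (e : E) {A B : Set (Config E)}
    (h : ∀ ω : Config E, ω e = false → (ω ∈ A ↔ ω ∈ B)) :
    prob (Function.update p e 0) A = prob (Function.update p e 0) B := by
  rw [← prob_update_zero_inter_closedEdge p A e, ← prob_update_zero_inter_closedEdge p B e]
  congr 1
  ext ω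
  simp only [Set.mem_inter_iff, closedEdge, Set.mem_setOf_eq]
  constructor
  · rintro ⟨hA, hc⟩; exact ⟨(h ω hc).1 hA, hc⟩
  · rintro ⟨hB, hc⟩; exact ⟨(h ω hc).2 hB, hc⟩

/-! ## Transport of `XW` and `D_sy` to the loop graph -/

omit [LinearOrder R] [IsStrictOrderedRing R] in
/-- Under `p[e↦0]`, `XW` does not see where the (closed) edge `e` is attached. -/
lemma xwBil_update_zero_eq (ends : E → Sym2 V) (s y o u : V) (p : E → R) (e : E) (x : Sym2 V) :
    xwBil ends s y o u (Function.update p e 0) (Function.update p e 0) =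
      xwBil (Function.update ends e x) s y o u (Function.update p e 0)
        (Function.update p e 0) := by
  unfold xwBil
  have h1 := prob_update_zero_congr (A := connEvent ends s u ∩ connEvent ends y o)
    (B := connEvent (Function.update ends e x) s u ∩ connEvent (Function.update ends e x) y o) p e
    (fun ω hω => by simp only [Set.mem_inter_iff, mem_connEvent, conn_update_of_closed ends x hω])
  have h2 := prob_update_zero_congr (A := connEvent ends s y ∩ connEvent ends s u)
    (B := connEvent (Function.update ends e x) s y ∩ connEvent (Function.update ends e x) s u) p e
    (fun ω hω => by simp only [Set.mem_inter_iff, mem_connEvent, conn_update_of_closed ends x hω])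
  have h3 := prob_update_zero_congr (A := connEvent ends s y ∩ connEvent ends y o)
    (B := connEvent (Function.update ends e x) s y ∩ connEvent (Function.update ends e x) y o) p e
    (fun ω hω => by simp only [Set.mem_inter_iff, mem_connEvent, conn_update_of_closed ends x hω])
  have h4 := prob_update_zero_congr (A := connEvent ends s u)
    (B := connEvent (Function.update ends e x) s u) p e
    (fun ω hω => by simp only [mem_connEvent, conn_update_of_closed ends x hω])
  have h5 := prob_update_zero_congr (A := connEvent ends y o)
    (B := connEvent (Function.update ends e x) y o) p e
    (fun ω hω => by simp only [mem_connEvent, conn_update_of_closed ends x hω])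
  have h6 := prob_update_zero_congr (A := connEvent ends s y)
    (B := connEvent (Function.update ends e x) s y) p e
    (fun ω hω => by simp only [mem_connEvent, conn_update_of_closed ends x hω])
  have h7 := prob_update_zero_congr
    (A := connEvent ends s y ∩ connEvent ends s u ∩ connEvent ends y o)
    (B := connEvent (Function.update ends e x) s y ∩ connEvent (Function.update ends e x) s u ∩
      connEvent (Function.update ends e x) y o) p e
    (fun ω hω => by simp only [Set.mem_inter_iff, mem_connEvent, conn_update_of_closed ends x hω])
  rw [h1, h2, h3, h4, h5, h6, h7]

omit [LinearOrder R] [IsStrictOrderedRing R] in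
/-- Under `p[e↦0]`, `D_sy` does not see where the (closed) edge `e` is attached. -/
lemma dSY_update_zero_eq (ends : E → Sym2 V) (s y o u : V) (p : E → R) (e : E) (x : Sym2 V) :
    XWEdgeSY.dSY ends s y o u (Function.update p e 0) =
      XWEdgeSY.dSY (Function.update ends e x) s y o u (Function.update p e 0) := by
  unfold XWEdgeSY.dSY XWEdgeSY.U XWEdgeSY.O
  have h1 := prob_update_zero_congr (A := (connEvent ends s y)ᶜ)
    (B := (connEvent (Function.update ends e x) s y)ᶜ) p e
    (fun ω hω => by simp only [Set.mem_compl_iff, mem_connEvent, conn_update_of_closed ends x hω])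
  have h2 := prob_update_zero_congr
    (A := (connEvent ends s y)ᶜ ∩ ((connEvent ends s u ∪ connEvent ends y u) ∩
      (connEvent ends y o ∪ connEvent ends s o)))
    (B := (connEvent (Function.update ends e x) s y)ᶜ ∩
      ((connEvent (Function.update ends e x) s u ∪ connEvent (Function.update ends e x) y u) ∩
      (connEvent (Function.update ends e x) y o ∪ connEvent (Function.update ends e x) s o))) p e
    (fun ω hω => by simp only [Set.mem_inter_iff, Set.mem_union, Set.mem_compl_iff, mem_connEvent,
      conn_update_of_closed ends x hω])
  have h3 := prob_update_zero_congr (A := (connEvent ends s y)ᶜ ∩ connEvent ends s u)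
    (B := (connEvent (Function.update ends e x) s y)ᶜ ∩ connEvent (Function.update ends e x) s u)
    p e (fun ω hω => by simp only [Set.mem_inter_iff, Set.mem_compl_iff, mem_connEvent,
      conn_update_of_closed ends x hω])
  have h4 := prob_update_zero_congr (A := (connEvent ends s y)ᶜ ∩ connEvent ends s o)
    (B := (connEvent (Function.update ends e x) s y)ᶜ ∩ connEvent (Function.update ends e x) s o)
    p e (fun ω hω => by simp only [Set.mem_inter_iff, Set.mem_compl_iff, mem_connEvent,
      conn_update_of_closed ends x hω])
  have h5 := prob_update_zero_congr (A := (connEvent ends s y)ᶜ ∩ connEvent ends y o)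
    (B := (connEvent (Function.update ends e x) s y)ᶜ ∩ connEvent (Function.update ends e x) y o)
    p e (fun ω hω => by simp only [Set.mem_inter_iff, Set.mem_compl_iff, mem_connEvent,
      conn_update_of_closed ends x hω])
  have h6 := prob_update_zero_congr
    (A := (connEvent ends s y)ᶜ ∩ (connEvent ends s u ∪ connEvent ends y u))
    (B := (connEvent (Function.update ends e x) s y)ᶜ ∩
      (connEvent (Function.update ends e x) s u ∪ connEvent (Function.update ends e x) y u)) p e
    (fun ω hω => by simp only [Set.mem_inter_iff, Set.mem_union, Set.mem_compl_iff, mem_connEvent,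
      conn_update_of_closed ends x hω])
  rw [h1, h2, h3, h4, h5, h6]

/-! ## The glued family with its `s–y` edge -/

/-- The block statistics of the glued family, read under `p[e↦0]` on the loop graph
`ends' = ends[e ↦ s(v, v)]`: `A₃·Δ_R + C₃·Δ_L − Δ_L·Δ_R`. -/
noncomputable def glueForm (ends : E → Sym2 V) (s y o u v : V) (p : E → R) : R :=
  prob p (connEvent ends u v ∩ (connEvent ends s v)ᶜ) *
      (prob p (connEvent ends y o ∩ connEvent ends y v) -
        prob p (connEvent ends y v) * prob p (connEvent ends y o)) +
    prob p (connEvent ends o v ∩ (connEvent ends y v)ᶜ) *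
      (prob p (connEvent ends s u ∩ connEvent ends s v) -
        prob p (connEvent ends s v) * prob p (connEvent ends s u)) -
    (prob p (connEvent ends s u ∩ connEvent ends s v) -
        prob p (connEvent ends s v) * prob p (connEvent ends s u)) *
      (prob p (connEvent ends y o ∩ connEvent ends y v) -
        prob p (connEvent ends y v) * prob p (connEvent ends y o))

omit [LinearOrder R] [IsStrictOrderedRing R] in
/-- **(XW) on the glued family with its `s–y` edge, exactly**: if `e = {s, y}` and `G` with `e`
re-attached as a loop at `v` has the cut vertex `v` separating `{s, u}` from `{y, o}`, then
`XW(G, p) = p_e (1 − p_e) · (A₃·Δ_R + C₃·Δ_L − Δ_L·Δ_R)`, the block statistics under `p[e↦0]`. -/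
theorem xwBil_eq_glue_edge {ends : E → Sym2 V} {side : E → Bool} {L : Set V} {v : V} {Rt : Set V}
    {e : E} {s u y o : V} (he : ends e = s(s, y))
    (h : CutVertex (Function.update ends e s(v, v)) side L v Rt)
    (hs : s ∈ L ∨ s = v) (hu : u ∈ L ∨ u = v) (hy : y ∈ Rt ∨ y = v) (ho : o ∈ Rt ∨ o = v)
    (p : E → R) :
    xwBil ends s y o u p p =
      p e * (1 - p e) * glueForm ends s y o u v (Function.update p e 0) := by
  rw [XWEdgeSY.xwBil_eq_sy_edge ends s y o u p he, xwBil_update_zero_eq ends s y o u p e s(v, v),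
    xwBil_eq_zero_of_cut_su_yo h hs hu hy ho, dSY_update_zero_eq ends s y o u p e s(v, v),
    XWGlue.dSY_eq_glue h hs hu hy ho]
  unfold glueForm
  -- the block events do not see the closed edge either
  have t : ∀ a b : V, prob (Function.update p e 0) (connEvent (Function.update ends e s(v, v)) a b) =
      prob (Function.update p e 0) (connEvent ends a b) := fun a b =>
    prob_update_zero_congr p e (fun ω hω => by simp only [mem_connEvent,
      conn_update_of_closed ends s(v, v) hω])
  have t2 : ∀ a b c d : V, prob (Function.update p e 0)
      (connEvent (Function.update ends e s(v, v)) a b ∩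
        connEvent (Function.update ends e s(v, v)) c d) =
      prob (Function.update p e 0) (connEvent ends a b ∩ connEvent ends c d) := fun a b c d =>
    prob_update_zero_congr p e (fun ω hω => by simp only [Set.mem_inter_iff, mem_connEvent,
      conn_update_of_closed ends s(v, v) hω])
  have t3 : ∀ a b c d : V, prob (Function.update p e 0)
      (connEvent (Function.update ends e s(v, v)) a b ∩
        (connEvent (Function.update ends e s(v, v)) c d)ᶜ) =
      prob (Function.update p e 0) (connEvent ends a b ∩ (connEvent ends c d)ᶜ) := fun a b c d =>
    prob_update_zero_congr p e (fun ω hω => by simp only [Set.mem_inter_iff, Set.mem_compl_iff,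
      mem_connEvent, conn_update_of_closed ends s(v, v) hω])
  simp only [t, t2, t3]
  ring

/-- **The exact criterion**: for `0 < p_e < 1`, (XW) fails on the glued family iff
`Δ_L·Δ_R > A₃·Δ_R + C₃·Δ_L`, i.e. iff the block form is negative — independently of `p_e`. -/
theorem xwBil_neg_iff_glue_edge {ends : E → Sym2 V} {side : E → Bool} {L : Set V} {v : V}
    {Rt : Set V} {e : E} {s u y o : V} (he : ends e = s(s, y))
    (h : CutVertex (Function.update ends e s(v, v)) side L v Rt)
    (hs : s ∈ L ∨ s = v) (hu : u ∈ L ∨ u = v) (hy : y ∈ Rt ∨ y = v) (ho : o ∈ Rt ∨ o = v)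
    (p : E → R) (h0 : 0 < p e) (h1 : p e < 1) :
    xwBil ends s y o u p p < 0 ↔ glueForm ends s y o u v (Function.update p e 0) < 0 := by
  rw [xwBil_eq_glue_edge he h hs hu hy ho p]
  have hpos : 0 < p e * (1 - p e) := mul_pos h0 (by linarith)
  constructor
  · intro hh
    by_cases hc : glueForm ends s y o u v (Function.update p e 0) < 0
    · exact hc
    · exact absurd hh (not_lt.2 (mul_nonneg hpos.le (not_lt.1 hc)))
  · intro hh
    exact mul_neg_of_pos_of_neg hpos hh

end XWGlueEdge

end Summit.Ventures.PercRepro2
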